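import Summits.NavierStokesRegularity.NavierStokesRegularity.Theorems.RootDecompLiouvilleHorizonHorizonCompactness
import Summits.NavierStokesRegularity.NavierStokesRegularity.Theorems.RootDecompLiouvilleHorizonKills
import Summits.NavierStokesRegularity.NavierStokesRegularity.Theorems.RootDecompLiouvilleHorizonTypeIGradientFloor
import HarnessLib

/-!
# Route `RootDecompLiouvilleHorizon` (N22): the TOP RUNG `SmoothingRung` (stmt-NavierStokesRegularity-32322), the bridge
# B♯ `RecordZoomBridge` (stmt-32032) and the `Assembly` (stmt-32034) — PROVED; and the bottom of the ladder:
# `ClayHorizon`, `BlowupHorizon` ⟸ (L) `TypeIliouvilleL` by theorem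

With CPT `HorizonCompactness` a theorem (`RootDecompLiouvilleHorizonHorizonCompactness.horizonCompactness_proof`) and
K1/K2/G landed (`RootDecompLiouvilleHorizonKills`, `RootDecompLiouvilleHorizonTypeIGradientFloor`), the horizon ladder
of the node `NavierStokesRegularity ⟸ BlowupHorizon ∧ TypeIGradientFloor ∧ NoRecordEulerianTypeII` closes at both ends:

* §1 TOP RUNG `smoothingRung_proof : SmoothingRung` (KNSS 2009 §4 smoothing, k = 1): there are `ε₀ > 0` and `S = 4`
  such that every Clay-class solution bounded by `M` on `(0, t] × ℝ³` with `4ν ≤ M²t` has `ν‖∇u(t)(y)‖ ≤ ε₀M²`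
  everywhere — normalise about `(t, y)` (`zoomN_window`), bound the gradient of the normalised field uniformly on
  `[−1, 0)` by the uniform end-of-window bound (`exists_uniform_end_gradient_bound`: KNSS (4.10) with k = 1 on time
  translates), pass to the end time by interior-time continuity (`zoomN_continuousAt_fderiv`) and undo the scaling
  (`zoomN_norm_fderiv_centre`).
* §2 B♯ `recordZoomBridge_proof : RecordZoomBridge`: the records of a record-viscous blow-up are exactly the
  witnesses CPT consumes (`RootDecompLiouvilleHorizonKills.exists_viscous_record_window`; port of the lens kernel
  `recordZoomBridge_of_compactness`), so B♯ ⟸ CPT ⟸ ⊤.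
* §3 THE BOTTOM OF THE LADDER IS (L): `clayHorizon_of_typeIliouvilleL : TypeIliouvilleL → ClayHorizon` ((L) kills the
  non-constant bounded ancient mild solution CPT produces), `blowupHorizon_of_clayHorizon`,
  `blowupHorizon_of_typeIliouvilleL`, and the route's `Assembly` `(L) → B♯ → E♯ → NavierStokesRegularity`
  (`rootDecompLiouvilleHorizon_assembly_proof`, through the deciding theorem `closes` with G, K1, K2 supplied by the
  kernel). After this file the open mathematics under N22 is exactly (L) `TypeIliouvilleL` (stmt-10661, the KNSS
  Liouville conjecture) and the declared residual E♯ `NoRecordEulerianTypeII` (stmt-32033); `BlowupHorizon` (stmt-32317)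
  stays separately attackable rung by rung below (L).

Def-free; axioms ⊆ {propext, Classical.choice, Quot.sound}.
Sources: [KochNadirashviliSereginSverak2009] arXiv:0709.3599 §1 (conjecture (L)), §4 (4.10), §6 (Prop 6.1, Thm 6.2);
Seregin 2014 lecture notes pp. 111–113. Lens provenance: decomp-ns lens 5, gen 22 (HOME/decomp-ns-lens-5/NODE-g22.md §4c).
-/

set_option linter.dupNamespace false

noncomputable section

open MeasureTheory Set Function Filter TopologicalSpace Metric
open scoped Topology ContDiff

namespace Summit.NavierStokesRegularity.NavierStokesRegularity.Theorems.RootDecompLiouvilleHorizonLadderTop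

open Literature.Analysis Literature.Analysis.FluidPDE
open Summit.NavierStokesRegularity.NavierStokesRegularity.Theorems
open Summit.NavierStokesRegularity.NavierStokesRegularity.Theorems.RootDecompLiouvilleHorizonHorizonCompactnessTools
open Summit.NavierStokesRegularity.NavierStokesRegularity.Theses.RootDecompLiouvilleHorizon

/-! ### §1 The top rung -/

/-- **Uniform gradient bound near the end of the window** (KNSS 2009 (4.10), k = 1, through the tree's
`exists_norm_iteratedFDeriv_le_of_bounded` applied to time translates): there is `K₁ ≥ 0` with
`‖∇v(σ)(x)‖ ≤ K₁` for `σ ∈ [−1, 0)` and every continuous, weakly divergence-free, Oseen-mild field on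
`(A, 0)`, `A ≤ −4`, bounded by `1`. [cite: KochNadirashviliSereginSverak2009, §4 (4.10) (arXiv:0709.3599 p. 8)] -/
theorem exists_uniform_end_gradient_bound :
    ∃ K₁ : ℝ, 0 ≤ K₁ ∧
      ∀ ⦃A : ℝ⦄ ⦃v : ℝ → EuclideanSpace ℝ (Fin 3) → EuclideanSpace ℝ (Fin 3)⦄, A ≤ -4 →
        ContinuousOn (uncurry v) (Ioo A 0 ×ˢ univ) →
        (∀ t ∈ Ioo A 0, IsWeaklyDivFree (v t)) →
        (∀ s t : ℝ, A < s → s < t → t < 0 → ∀ x,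
          v t x = UnboundedOperators.heatExtension (v s) (t - s) x - oseenDuhamel 1 s v v t x) →
        (∀ t ∈ Ioo A 0, ∀ x, ‖v t x‖ ≤ 1) →
        ∀ σ ∈ Ico (-1 : ℝ) 0, ∀ x, ‖fderiv ℝ (v σ) x‖ ≤ K₁ := by
  obtain ⟨K, hK⟩ := TypeIliouvilleNoTypeII.ImmortalZoom.exists_norm_iteratedFDeriv_le_of_bounded
    (1 : ℝ) 1 (a := -3) (b := 0) (δ := 1) (by norm_num) one_pos
  refine ⟨max K 0, le_max_right _ _, fun A v hA hc hdiv hmild hbd σ hσ x => ?_⟩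
  obtain ⟨hc', hdiv', hmild', hbd'⟩ := window_translate hc hdiv hmild hbd (σ / 2)
  have h := hK (A := A - σ / 2) (B := 0 - σ / 2) (by linarith [hσ.1]) (by linarith [hσ.2])
    hc' hdiv' hmild' hbd' (σ / 2) ⟨by linarith [hσ.1], by linarith [hσ.2]⟩ x
  rw [add_halves] at h
  rw [← norm_iteratedFDeriv_zero (𝕜 := ℝ) (f := fderiv ℝ (v σ)), norm_iteratedFDeriv_fderiv]
  exact h.trans (le_max_left _ _)

/-- **TOP RUNG `SmoothingRung` (item stmt-NavierStokesRegularity-32322) — PROVED** (KNSS smoothing, k = 1):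
with `S = 4`, every Clay-class solution bounded by `M` on `(0, t] × ℝ³` with `4ν ≤ M²t` has
`ν‖∇u(t)(y)‖ ≤ ε₀ M²` for all `y`, `ε₀ = K₁ + 1`. [cite: KochNadirashviliSereginSverak2009, §4 (4.10) (arXiv:0709.3599 p. 8)] -/
theorem smoothingRung_proof : SmoothingRung := by
  obtain ⟨K₁, hK₁0, hK₁⟩ := exists_uniform_end_gradient_bound
  refine ⟨K₁ + 1, by linarith, 4, by norm_num, ?_⟩
  intro ν T hν hT u p hsol hLH hdec t ht M hS hbd y
  have hM0 : 0 ≤ M := (norm_nonneg _).trans (hbd t ⟨ht.1, le_rfl⟩ y)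
  rcases hM0.eq_or_lt with h0 | hM
  · have hu0 : u t = fun _ => 0 := funext fun z => by
      have hz := hbd t ⟨ht.1, le_rfl⟩ z
      rw [← h0] at hz
      exact norm_le_zero_iff.1 hz
    subst h0
    rw [hu0]
    simp
  · set R : ℝ := ν / M with hRdef
    set α : ℝ := R / ν with hαdef
    set β : ℝ := R ^ 2 / ν with hβdef
    have hβν : β = ν / M ^ 2 := by
      simp only [hβdef, hRdef]
      field_simp
    have hβ0 : 0 < β := by rw [hβν]; positivity
    obtain ⟨hc, hdiv, hmild, hb1⟩ :=
      zoomN_window (y := y) hν hsol hLH hdec ht hM hbd hRdef hαdef hβdef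
    have hA : -(t / β) ≤ -4 := by
      have h1 : 4 * β ≤ t := by
        rw [hβν]
        calc 4 * (ν / M ^ 2) = 4 * ν / M ^ 2 := by ring
          _ ≤ M ^ 2 * t / M ^ 2 := div_le_div_of_nonneg_right hS (by positivity)
          _ = t := mul_div_cancel_left₀ t (pow_ne_zero 2 hM.ne')
      have h2 : 4 ≤ t / β := by rwa [le_div_iff₀ hβ0]
      linarith
    have hgrad : ∀ σ ∈ Ico (-1 : ℝ) 0, ‖fderiv ℝ ((α • stPull β R t y u) σ) 0‖ ≤ K₁ := fun σ hσ =>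
      hK₁ hA hc hdiv hmild hb1 σ hσ 0
    have hcont : Tendsto (fun σ => fderiv ℝ ((α • stPull β R t y u) σ) 0) (𝓝[<] 0)
        (𝓝 (fderiv ℝ ((α • stPull β R t y u) 0) 0)) :=
      (zoomN_continuousAt_fderiv (R := R) (α := α) (β := β) (y := y) hsol ht).tendsto.mono_left
        nhdsWithin_le_nhds
    have hle : ‖fderiv ℝ ((α • stPull β R t y u) 0) 0‖ ≤ K₁ := by
      refine le_of_tendsto hcont.norm ?_
      filter_upwards [Ioo_mem_nhdsLT (show (-1 : ℝ) < 0 by norm_num)] with σ hσ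
      exact hgrad σ ⟨hσ.1.le, hσ.2⟩
    rw [zoomN_norm_fderiv_centre (β := β) (y := y) hν hsol ht hM hRdef hαdef] at hle
    have hM2 : 0 < M ^ 2 := by positivity
    rw [div_mul_eq_mul_div, div_le_iff₀ hM2] at hle
    nlinarith [hle, hM2]

/-! ### §2 The bridge B♯ from CPT -/

/-- **CPT covers B♯**: the records of a record-viscous blow-up are exactly the witnesses CPT asks for
(port of the lens kernel `recordZoomBridge_of_compactness`, HorizonLadder.lean §6). [cite: KochNadirashviliSereginSverak2009, §6 (arXiv:0709.3599 p. 13)] -/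
theorem recordZoomBridge_of_horizonCompactness (hC : HorizonCompactness) : RecordZoomBridge := by
  intro ν T hν hT u p hmax hLH hdec hH
  obtain ⟨R, hR⟩ := hH
  have hRpos : 0 < R := by
    by_contra hle
    push Not at hle
    obtain ⟨t, x, hx1, -, y, hvis⟩ := hR.exists
    have hg : 0 ≤ ν * ‖fderiv ℝ (u t) y‖ := by positivity
    have h1 : R * ν * ‖fderiv ℝ (u t) y‖ ≤ 0 := by
      have : R * (ν * ‖fderiv ℝ (u t) y‖) ≤ 0 := mul_nonpos_of_nonpos_of_nonneg hle hg
      simpa [mul_assoc] using this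
    nlinarith [hvis, h1, hx1]
  have hε : (0 : ℝ) < 1 / (8 * R) := by positivity
  refine hC (1 / (8 * R)) hε fun S _hS => ?_
  obtain ⟨t, ht, x, hx1, hrec, ⟨y, hvis⟩, hwin⟩ :=
    RootDecompLiouvilleHorizonKills.exists_viscous_record_window hν hT hmax hLH hdec hR S
  refine ⟨ν, T, hν, hT, u, p, hmax.1, hLH, hdec, t, ht, 2 * ‖u t x‖, hwin, hrec, y, ?_⟩
  have ha2 : 1 ≤ ‖u t x‖ ^ 2 := by nlinarith
  have key : 1 / (8 * R) * (2 * ‖u t x‖) ^ 2 = ‖u t x‖ ^ 2 / (2 * R) := by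
    field_simp
    ring
  rw [key, div_lt_iff₀ (by positivity)]
  nlinarith [hvis, ha2, hRpos]

/-- **B♯ `RecordZoomBridge` (item stmt-NavierStokesRegularity-32032) — PROVED** (CPT is a theorem). [cite: KochNadirashviliSereginSverak2009, §6 Thm 6.2 (arXiv:0709.3599 p. 13)] -/
theorem recordZoomBridge_proof : RecordZoomBridge :=
  recordZoomBridge_of_horizonCompactness RootDecompLiouvilleHorizonHorizonCompactness.horizonCompactness_proof

/-! ### §3 The bottom of the ladder is (L) -/

/-- (L) and CPT give every rung of the Clay-class horizon (lens kernel `clayHorizon_of_L_compactness`). [cite: KochNadirashviliSereginSverak2009, §1 and §6 (arXiv:0709.3599 pp. 2, 13)] -/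
theorem clayHorizon_of_typeIliouvilleL_horizonCompactness (hL : TypeIliouvilleL) (hC : HorizonCompactness) :
    ClayHorizon := by
  intro ε hε
  by_contra h
  push Not at h
  obtain ⟨w, hw, hmeas, s, hs, hnc⟩ := hC ε hε h
  exact hnc (hL w hw hmeas s hs)

/-- **Q `ClayHorizon` ⟸ (L)** (CPT is a theorem). [cite: KochNadirashviliSereginSverak2009, §1 (arXiv:0709.3599 p. 2)] -/
theorem clayHorizon_of_typeIliouvilleL (hL : TypeIliouvilleL) : ClayHorizon :=
  clayHorizon_of_typeIliouvilleL_horizonCompactness hL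
    RootDecompLiouvilleHorizonHorizonCompactness.horizonCompactness_proof

/-- **Q ⟹ Q♭** (a maximal smooth solution is classical on `[0, T)`). [folklore] -/
theorem blowupHorizon_of_clayHorizon (hQ : ClayHorizon) : BlowupHorizon := fun ε hε => by
  obtain ⟨S, hS, hr⟩ := hQ ε hε
  exact ⟨S, hS, fun ν T hν hT u p hmax => hr ν T hν hT u p hmax.1⟩

/-- **Q♭ `BlowupHorizon` ⟸ (L)**. [cite: KochNadirashviliSereginSverak2009, §1 (arXiv:0709.3599 p. 2)] -/
theorem blowupHorizon_of_typeIliouvilleL (hL : TypeIliouvilleL) : BlowupHorizon :=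
  blowupHorizon_of_clayHorizon (clayHorizon_of_typeIliouvilleL hL)

/-- **Q ⟹ the top rung** (trivially, `ε₀ = 1`). [folklore] -/
theorem smoothingRung_of_clayHorizon (hQ : ClayHorizon) : SmoothingRung := ⟨1, one_pos, hQ 1 one_pos⟩

/-- **The route's `Assembly` (item stmt-NavierStokesRegularity-32034) — PROVED**: `(L) → B♯ → E♯ → Clay (A)`
through the deciding theorem `closes`, with Q♭ from (L) (§3), G (`typeIGradientFloor_proof`), K1/K2
(`horizonRecordKill_proof`, `horizonTypeIKill_proof`) supplied by the kernel; B♯ is not even needed.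
[cite: KochNadirashviliSereginSverak2009, §6 Thm 6.2 (arXiv:0709.3599 p. 13)] -/
theorem rootDecompLiouvilleHorizon_assembly_proof : Assembly := fun hL _hB hE =>
  closes (blowupHorizon_of_typeIliouvilleL hL)
    RootDecompLiouvilleHorizonTypeIGradientFloor.typeIGradientFloor_proof hE
    RootDecompLiouvilleHorizonKills.horizonRecordKill_proof
    RootDecompLiouvilleHorizonKills.horizonTypeIKill_proof

end Summit.NavierStokesRegularity.NavierStokesRegularity.Theorems.RootDecompLiouvilleHorizonLadderTop

end
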